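import Literature.MathematicalPhysics.QuantumFieldTheory.Balaban1983to89.B13OpsYPencilRProj
import Literature.MathematicalPhysics.QuantumFieldTheory.Balaban1983to89.B13OpsYPencilGreenPrimeSym

/-!
# `Balaban1983to89.B13OpsYPencilXQuadGen` — T. Bałaban, *Propagators for lattice gauge theories in a background field*, Commun. Math. Phys. **99** (1985)
389–434 [Balaban1985BackgroundPropagators], (3.19)–(3.21) pp. 393–394, (3.24)–(3.25) pp. 394–395, Thm 3.2 p. 398, (3.48) p. 398, Thm 3.4 p. 400, Sect. B (3.66)–(3.68) p. 403,
(3.69)–(3.70) p. 404, Thm 3.10 (3.107)–(3.108) p. 416; *Renormalization group approach to lattice gauge field theories. II*, Commun. Math. Phys. **116** (1988) 1–22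
[Balaban1988RG2Cluster] (2.5)–(2.7) pp. 12–13, p. 15: THE X-STATION MADE TRANSPORTER-GENERIC — `X = Q′G′²Q′*` and `X⁻¹` along pv27's pencil in the N10
currency for ANY site transporter letter `parS` and ANY `G′`-letter `Gp` (def-Y's v2 `parSY` ∕ v4 `parSymY` fork located by dag-n10-c g15: which is «of record»
is NODE 00's ∕ def-T's word), with the v2 instance (= `B13OpsYPencilXQuad`'s statement, via 73) and the v4 instance (via the lane's 78
`B13OpsYPencilGreenPrimeSym` §1).

* §1 the site-indexed sums in `B13OpsYPencilRProj` §1's hypothesis format (holomorphy of `A′ ↦ qpT i parS (e^{iηA′}U₀) s z` and of its inverse, ONE numeral `KQ`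
  on the supports): `rowSum_site_toMatrix_QpY_le_of` (numeral `CQ ≥ Σ_z|qpK(s,z)|`), `colSum_site_toMatrix_QpsY_le_of` (numeral `CQs ≥ Σ_z|qpsK(z,s)|`).
* §2 ★★ `rawEntryLetters_toMatrix_XY_prodCfg_of` — `X(e^{iηA′}U₀)` along the pencil for ANY `parS, Gp`, from `Gp`'s pencil letters (displayed), (D′) + 34.
* §3 ★★★ `rawEntryLetters_toMatrix_XinvY_prodCfg_of_pencil_of` — the X⁻¹-junction for ANY `parS, Gp` (p601656 §5, `prodCfg_zero`, p599011 `XY_mul_XinvY`), displaying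
  N06's `IsUnit (X(U₀))` + the (3.48)∕(3.108)-type kernel bound at the ONE real background.
* §4 instances: `rawEntryLetters_toMatrix_XinvY_parSY_prodCfg_of_pencil` (v2, transporter facts by 73, `KQ = Kη^D`) and
  `rawEntryLetters_toMatrix_XinvY_parSymY_prodCfg_of_pencil` (v4, transporter facts by 78 §1, same numeral).
HONEST FRAMING: readers + located numerals over (D′) ∕ 34 ∕ 73 ∕ 78 ∕ p599011–p606744; NODE 00's `QpY ∕ QpsY ∕ qpT ∕ XY ∕ XinvY ∕ parSY ∕ parSymY`, pv27's `prodCfg`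
CONSUMED BY NAME, nothing of `Node00/OpsY*` modified; Theorem 3.2 ∕ 3.10 at the centre stays N06's displayed content; nothing of Bałaban's asserted; N06 ∕ N10
NOT discharged; K1⁷ NOT closed; counts unmoved (typed 28∕28 · discharged 5∕27); THEOREMS ONLY, 0 `sorry`, standard axioms; one finite 𝕋⁴ programme at fixed ε —
R4 closes the conditional finite-𝕋⁴ rung `BalabanLadder.UV` only; the YM mass gap (Clay) is NOT proved by any of this; nothing continuum ∕ ℝ⁴ ∕ OS.
DOC-ONLY EDITION (dag-n10-w2 g4, 2026-08-28): [B9] page locators corrected per the page owner lit-balaban-r06 — (3.25) p.394; (3.48) p.398; (3.60)–(3.65) p.402,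
(3.66)–(3.68) p.403, (3.69)–(3.70) p.404, (3.71)–(3.72) p.405; (3.84)–(3.86) p.407 only; every declaration byte-identical to the previous edition.
-/

noncomputable section

namespace Literature.MathematicalPhysics.QuantumFieldTheory.Balaban1983to89.B13OpsYPencilXQuadGen

open Metric Set Finset Module
open scoped Matrix
open Literature.MathematicalPhysics.QuantumFieldTheory.Balaban1983to89
open Literature.MathematicalPhysics.QuantumFieldTheory.Balaban1983to89.B9Thm37GlueTorus (tdist1)
open Literature.MathematicalPhysics.QuantumFieldTheory.Balaban1983to89.B5TorusCover (UT)
open Literature.MathematicalPhysics.QuantumFieldTheory.Balaban1983to89.B13EntrywiseWalks (RawEntryLetters)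
open Literature.MathematicalPhysics.QuantumFieldTheory.Balaban1983to89.B13EntryLetterAlgebra (rawEntryLetters_mono rawEntryLetters_congr rawEntryLetters_mul_torus)
open Literature.MathematicalPhysics.QuantumFieldTheory.Balaban1983to89.B13EntryLetterAlgebraFamily (rawEntryLetters_sandwich_family)
open Literature.MathematicalPhysics.QuantumFieldTheory.Balaban1983to89.B13InverseOperatorCoordinates
  (rawEntryLetters_toMatrix_ringInverse_located_of_kernelBound XY_mul_XinvY)
open Literature.MathematicalPhysics.QuantumFieldTheory.Balaban1983to89.B13OpsYPencilXQuad
  (toMatrix_XY_eq tdist_le_of_toMatrix_QpY_ne_zero tdist_le_of_toMatrix_QpsY_ne_zero)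
open Literature.MathematicalPhysics.QuantumFieldTheory.Balaban1983to89.B13OpsYPencilRProj
  (differentiableOn_toMatrix_QpY_prodCfg_of differentiableOn_toMatrix_QpsY_prodCfg_of norm_toMatrix_QpY_prodCfg_le_of norm_toMatrix_QpsY_prodCfg_le_of)
open Literature.MathematicalPhysics.QuantumFieldTheory.Balaban1983to89.B13OpsYPencilAveraging
  (differentiableOn_qpT_prodCfg differentiableOn_qpT_inv_prodCfg norm_qpT_prodCfg_le norm_qpT_inv_prodCfg_le)
open Literature.MathematicalPhysics.QuantumFieldTheory.Balaban1983to89.B13OpsYPencilGreenPrimeSym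
  (differentiableOn_parSymY_prodCfg differentiableOn_parSymY_inv_prodCfg norm_parSymY_prodCfg_le norm_parSymY_inv_prodCfg_le)
open Literature.MathematicalPhysics.QuantumFieldTheory.Balaban1983to89.B9Eq39Adjoint (prodCfg)
open Literature.MathematicalPhysics.QuantumFieldTheory.Balaban1983to89.B9Eq369Product (prodCfg_zero)
open Literature.MathematicalPhysics.QuantumFieldTheory.Balaban1983to89.B6GlobalChartV1 (PV boxEquiv)
open Literature.MathematicalPhysics.QuantumFieldTheory.Balaban1983to89.B6KLevelCensusIndexV1 (KIdx)
open Literature.MathematicalPhysics.QuantumFieldTheory.Balaban1983to89.Node00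

variable {𝔸 : Type} [NormedRing 𝔸] [NormedAlgebra ℂ 𝔸] [CompleteSpace 𝔸]
variable {d ℓ : ℕ} {hd : 1 ≤ d + 1} {hL : Odd (ℓ + 1) ∧ 1 < ℓ + 1} {b₀ b₁ : ℝ}
variable (i : KIdx d ℓ hd hL b₀ b₁)
variable {κ : Type} [Fintype κ] [DecidableEq κ] (b : Basis κ ℂ 𝔸)
variable (parS : SiteParY 𝔸 i) (U₀ : CfgY 𝔸 i) (η : ℝ) {Rc KQ : ℝ}
variable [DecidableEq (SiteY i)] [DecidableEq (BlkY i)]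
variable {ν : ℕ} {Nf : Fin ν → ℕ} [∀ j, NeZero (Nf j)]

/-! ## §1. Site-indexed sums of the transporter-generic `Q′ ∕ Q′*` families -/

section Sums

omit [DecidableEq (BlkY i)] in
/-- `Q′`, ANY `parS`: ROW SUMS over the site index `Σ_{(z,l)} ‖toMatrix(Q′)(s,k)(z,l)‖ ≤ CQ·|κ|·(cb·(KQ·cl·KQ))`, numeral `CQ ≥ Σ_z |qpK(s,z)|`.
[cite: Balaban1985BackgroundPropagators, (3.19) p.393; Balaban1984PropagatorsII, (2.54) p.232] -/
theorem rowSum_site_toMatrix_QpY_le_of {cb cl : ℝ} (hcb : ∀ (x : 𝔸) (k : κ), ‖b.repr x k‖ ≤ cb * ‖x‖) (hcb0 : 0 ≤ cb) (hcl : ∀ l, ‖b l‖ ≤ cl)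
    (hcl0 : 0 ≤ cl) (hKQ : 0 ≤ KQ)
    (hQf : ∀ a ∈ ball (0 : Fin (d + 1) → Site (PV d ℓ i.m i.K hd hL) 0 → 𝔸) Rc, ∀ s z, qpK i s z ≠ 0 → ‖(qpT i parS (prodCfg U₀ η a) s z : 𝔸)‖ ≤ KQ)
    (hQb : ∀ a ∈ ball (0 : Fin (d + 1) → Site (PV d ℓ i.m i.K hd hL) 0 → 𝔸) Rc, ∀ s z, qpK i s z ≠ 0 →
      ‖(((qpT i parS (prodCfg U₀ η a) s z)⁻¹ : 𝔸ˣ) : 𝔸)‖ ≤ KQ)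
    {CQ : ℝ} (hCQ : ∀ s, ∑ z, |qpK i s z| ≤ CQ)
    {a : Fin (d + 1) → Site (PV d ℓ i.m i.K hd hL) 0 → 𝔸} (ha : a ∈ ball 0 Rc) (p : BlkY i × κ) :
    ∑ q : SiteY i × κ, ‖LinearMap.toMatrix ((Pi.basis fun _ : SiteY i => b).reindex (Equiv.sigmaEquivProd (SiteY i) κ))
      ((Pi.basis fun _ : BlkY i => b).reindex (Equiv.sigmaEquivProd (BlkY i) κ)) (QpY i parS (prodCfg U₀ η a)) p q‖ ≤ CQ * (Fintype.card κ : ℝ) * (cb * (KQ * cl * KQ)) := by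
  set c : ℝ := cb * (KQ * cl * KQ) with hc
  have hc0 : 0 ≤ c := mul_nonneg hcb0 (mul_nonneg (mul_nonneg hKQ hcl0) hKQ)
  calc ∑ q : SiteY i × κ, ‖LinearMap.toMatrix ((Pi.basis fun _ : SiteY i => b).reindex (Equiv.sigmaEquivProd (SiteY i) κ))
          ((Pi.basis fun _ : BlkY i => b).reindex (Equiv.sigmaEquivProd (BlkY i) κ)) (QpY i parS (prodCfg U₀ η a)) p q‖
      ≤ ∑ q : SiteY i × κ, |qpK i p.1 q.1| * c :=
        Finset.sum_le_sum fun q _ => norm_toMatrix_QpY_prodCfg_le_of i b parS U₀ η hcb hcb0 hcl hKQ hQf hQb ha p q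
    _ = (∑ z : SiteY i, |qpK i p.1 z|) * (Fintype.card κ : ℝ) * c := by
        rw [Fintype.sum_prod_type, Finset.sum_mul, Finset.sum_mul]
        refine Finset.sum_congr rfl fun z _ => ?_
        show ∑ _y : κ, |qpK i p.1 z| * c = _
        rw [Finset.sum_const, Finset.card_univ, nsmul_eq_mul]
        ring
    _ ≤ CQ * (Fintype.card κ : ℝ) * c :=
        mul_le_mul_of_nonneg_right (mul_le_mul_of_nonneg_right (hCQ p.1) (Nat.cast_nonneg _)) hc0

omit [DecidableEq (SiteY i)] in
/-- `Q′*`, ANY `parS`: COLUMN SUMS over the site index `Σ_{(z,l)} ‖toMatrix(Q′*)(z,l)(s,k)‖ ≤ CQs·|κ|·(cb·(KQ·cl·KQ))`, numeral `CQs ≥ Σ_z |qpsK(z,s)|`.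
[cite: Balaban1985BackgroundPropagators, (3.24) p.394; Balaban1984PropagatorsII, (2.54) p.232] -/
theorem colSum_site_toMatrix_QpsY_le_of {cb cl : ℝ} (hcb : ∀ (x : 𝔸) (k : κ), ‖b.repr x k‖ ≤ cb * ‖x‖) (hcb0 : 0 ≤ cb) (hcl : ∀ l, ‖b l‖ ≤ cl)
    (hcl0 : 0 ≤ cl) (hKQ : 0 ≤ KQ)
    (hQsf : ∀ a ∈ ball (0 : Fin (d + 1) → Site (PV d ℓ i.m i.K hd hL) 0 → 𝔸) Rc, ∀ z s, qpsK i z s ≠ 0 →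
      ‖(((qpT i parS (prodCfg U₀ η a) s z)⁻¹ : 𝔸ˣ) : 𝔸)‖ ≤ KQ)
    (hQsb : ∀ a ∈ ball (0 : Fin (d + 1) → Site (PV d ℓ i.m i.K hd hL) 0 → 𝔸) Rc, ∀ z s, qpsK i z s ≠ 0 → ‖(qpT i parS (prodCfg U₀ η a) s z : 𝔸)‖ ≤ KQ)
    {CQs : ℝ} (hCQs : ∀ s, ∑ z, |qpsK i z s| ≤ CQs)
    {a : Fin (d + 1) → Site (PV d ℓ i.m i.K hd hL) 0 → 𝔸} (ha : a ∈ ball 0 Rc) (p : BlkY i × κ) :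
    ∑ q : SiteY i × κ, ‖LinearMap.toMatrix ((Pi.basis fun _ : BlkY i => b).reindex (Equiv.sigmaEquivProd (BlkY i) κ))
      ((Pi.basis fun _ : SiteY i => b).reindex (Equiv.sigmaEquivProd (SiteY i) κ)) (QpsY i parS (prodCfg U₀ η a)) q p‖ ≤ CQs * (Fintype.card κ : ℝ) * (cb * (KQ * cl * KQ)) := by
  set c : ℝ := cb * (KQ * cl * KQ) with hc
  have hc0 : 0 ≤ c := mul_nonneg hcb0 (mul_nonneg (mul_nonneg hKQ hcl0) hKQ)
  calc ∑ q : SiteY i × κ, ‖LinearMap.toMatrix ((Pi.basis fun _ : BlkY i => b).reindex (Equiv.sigmaEquivProd (BlkY i) κ))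
          ((Pi.basis fun _ : SiteY i => b).reindex (Equiv.sigmaEquivProd (SiteY i) κ)) (QpsY i parS (prodCfg U₀ η a)) q p‖
      ≤ ∑ q : SiteY i × κ, |qpsK i q.1 p.1| * c :=
        Finset.sum_le_sum fun q _ => norm_toMatrix_QpsY_prodCfg_le_of i b parS U₀ η hcb hcb0 hcl hKQ hQsf hQsb ha q p
    _ = (∑ z : SiteY i, |qpsK i z p.1|) * (Fintype.card κ : ℝ) * c := by
        rw [Fintype.sum_prod_type, Finset.sum_mul, Finset.sum_mul]
        refine Finset.sum_congr rfl fun z _ => ?_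
        show ∑ _y : κ, |qpsK i z p.1| * c = _
        rw [Finset.sum_const, Finset.card_univ, nsmul_eq_mul]
        ring
    _ ≤ CQs * (Fintype.card κ : ℝ) * c :=
        mul_le_mul_of_nonneg_right (mul_le_mul_of_nonneg_right (hCQs p.1) (Nat.cast_nonneg _)) hc0

end Sums

/-! ## §2. ★★ `X = Q′G′²Q′*` along the pencil, transporter-generic -/

section XQuad

/-- ★★ **`X = Q′G′²Q′*` ALONG THE PENCIL FOR ANY `parS`, `Gp`** ((3.66)–(3.70) in the letter currency): from `Gp`'s pencil letters `(Rc, ρ, B_G′)` on sites (displayed), a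
fibre bound `m_S`, a rate loss `0 < μ ≤ ρ`, the transporter facts `hQh hQhi hQf hQb hQsf hQsb` with numeral `KQ ≥ 0`, kernel sums `CQ, CQs ≥ 0`, reading `r`, basis
numerals: `RawEntryLetters (A′ ↦ toMatrix (X(e^{iηA′}U₀))) (ℓB ∘ fst) Rc (ρ − μ) (a·b·(B_G′²·(m_S·c₀(1,μ)^ν))·e^{2(ρ−μ)r})` — (D′) sandwich + 34.
[cite: Balaban1985BackgroundPropagators, (3.25) p.394, Thm 3.4 p.400, (3.66)–(3.68) p.403, (3.69)–(3.70) p.404, Thm 3.10 (3.108) p.416; Balaban1988RG2Cluster, (2.5)–(2.6) p.12;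
Balaban1984PropagatorsII, (2.54) p.232, Lemma 2.1 (2.61) p.234] -/
theorem rawEntryLetters_toMatrix_XY_prodCfg_of (Gp : SiteOpY 𝔸 i) {cb cl : ℝ}
    (hcb : ∀ (x : 𝔸) (k : κ), ‖b.repr x k‖ ≤ cb * ‖x‖) (hcb0 : 0 ≤ cb) (hcl : ∀ l, ‖b l‖ ≤ cl) (hcl0 : 0 ≤ cl) (hKQ : 0 ≤ KQ)
    (hQh : ∀ s z, DifferentiableOn ℂ (fun a : Fin (d + 1) → Site (PV d ℓ i.m i.K hd hL) 0 → 𝔸 => (qpT i parS (prodCfg U₀ η a) s z : 𝔸)) (ball 0 Rc))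
    (hQhi : ∀ s z, DifferentiableOn ℂ (fun a : Fin (d + 1) → Site (PV d ℓ i.m i.K hd hL) 0 → 𝔸 =>
      (((qpT i parS (prodCfg U₀ η a) s z)⁻¹ : 𝔸ˣ) : 𝔸)) (ball 0 Rc))
    (hQf : ∀ a ∈ ball (0 : Fin (d + 1) → Site (PV d ℓ i.m i.K hd hL) 0 → 𝔸) Rc, ∀ s z, qpK i s z ≠ 0 → ‖(qpT i parS (prodCfg U₀ η a) s z : 𝔸)‖ ≤ KQ)
    (hQb : ∀ a ∈ ball (0 : Fin (d + 1) → Site (PV d ℓ i.m i.K hd hL) 0 → 𝔸) Rc, ∀ s z, qpK i s z ≠ 0 →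
      ‖(((qpT i parS (prodCfg U₀ η a) s z)⁻¹ : 𝔸ˣ) : 𝔸)‖ ≤ KQ)
    (hQsf : ∀ a ∈ ball (0 : Fin (d + 1) → Site (PV d ℓ i.m i.K hd hL) 0 → 𝔸) Rc, ∀ z s, qpsK i z s ≠ 0 →
      ‖(((qpT i parS (prodCfg U₀ η a) s z)⁻¹ : 𝔸ˣ) : 𝔸)‖ ≤ KQ)
    (hQsb : ∀ a ∈ ball (0 : Fin (d + 1) → Site (PV d ℓ i.m i.K hd hL) 0 → 𝔸) Rc, ∀ z s, qpsK i z s ≠ 0 → ‖(qpT i parS (prodCfg U₀ η a) s z : 𝔸)‖ ≤ KQ)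
    {CQ CQs : ℝ} (hCQ0 : 0 ≤ CQ) (hCQ : ∀ s, ∑ z, |qpK i s z| ≤ CQ) (hCQs0 : 0 ≤ CQs) (hCQs : ∀ s, ∑ z, |qpsK i z s| ≤ CQs)
    (ℓS : SiteY i → UT Nf) (ℓB : BlkY i → UT Nf) {r : ℝ}
    (hℓQ : ∀ s z, qpK i s z ≠ 0 → tdist1 Nf (ℓB s) (ℓS z) ≤ r) (hℓQs : ∀ z s, qpsK i z s ≠ 0 → tdist1 Nf (ℓS z) (ℓB s) ≤ r)
    {mS : ℕ} (hfibS : ∀ y : UT Nf, (univ.filter fun q : SiteY i × κ => ℓS q.1 = y).card ≤ mS)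
    {ρ BG μ : ℝ}
    (hG : RawEntryLetters (fun a : Fin (d + 1) → Site (PV d ℓ i.m i.K hd hL) 0 → 𝔸 =>
      LinearMap.toMatrix ((Pi.basis fun _ : SiteY i => b).reindex (Equiv.sigmaEquivProd (SiteY i) κ))
        ((Pi.basis fun _ : SiteY i => b).reindex (Equiv.sigmaEquivProd (SiteY i) κ)) (Gp (prodCfg U₀ η a)))
      (fun q : SiteY i × κ => ℓS q.1) Rc ρ BG)
    (hμ : 0 < μ) (hμρ : μ ≤ ρ) :
    RawEntryLetters (fun a : Fin (d + 1) → Site (PV d ℓ i.m i.K hd hL) 0 → 𝔸 =>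
        LinearMap.toMatrix ((Pi.basis fun _ : BlkY i => b).reindex (Equiv.sigmaEquivProd (BlkY i) κ))
          ((Pi.basis fun _ : BlkY i => b).reindex (Equiv.sigmaEquivProd (BlkY i) κ)) (XY i parS Gp (prodCfg U₀ η a)))
      (fun p : BlkY i × κ => ℓB p.1) Rc (ρ - μ)
      (CQ * (Fintype.card κ : ℝ) * (cb * (KQ * cl * KQ)) * (CQs * (Fintype.card κ : ℝ) * (cb * (KQ * cl * KQ))) *
        (BG * BG * (mS * B6.c0 1 μ ^ ν)) * Real.exp (2 * (ρ - μ) * r)) := by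
  have hG2 := rawEntryLetters_mul_torus hG hG hμ (κ := ρ - μ) (by linarith) (by linarith) (by linarith) hfibS
  have hc0 : 0 ≤ cb * (KQ * cl * KQ) := mul_nonneg hcb0 (mul_nonneg (mul_nonneg hKQ hcl0) hKQ)
  have ha0 : 0 ≤ CQ * (Fintype.card κ : ℝ) * (cb * (KQ * cl * KQ)) := mul_nonneg (mul_nonneg hCQ0 (Nat.cast_nonneg _)) hc0
  have hb0 : 0 ≤ CQs * (Fintype.card κ : ℝ) * (cb * (KQ * cl * KQ)) := mul_nonneg (mul_nonneg hCQs0 (Nat.cast_nonneg _)) hc0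
  have hS := rawEntryLetters_sandwich_family (locp := fun p : BlkY i × κ => ℓB p.1) hG2 (by linarith)
    (A := fun a => LinearMap.toMatrix ((Pi.basis fun _ : SiteY i => b).reindex (Equiv.sigmaEquivProd (SiteY i) κ))
        ((Pi.basis fun _ : BlkY i => b).reindex (Equiv.sigmaEquivProd (BlkY i) κ)) (QpY i parS (prodCfg U₀ η a)))
    (B' := fun a => LinearMap.toMatrix ((Pi.basis fun _ : BlkY i => b).reindex (Equiv.sigmaEquivProd (BlkY i) κ))
        ((Pi.basis fun _ : SiteY i => b).reindex (Equiv.sigmaEquivProd (SiteY i) κ)) (QpsY i parS (prodCfg U₀ η a)))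
    (r := r) ha0 hb0
    (fun p q => differentiableOn_toMatrix_QpY_prodCfg_of i b parS U₀ η hcb hQh hQhi p q)
    (fun a _ p q hne => tdist_le_of_toMatrix_QpY_ne_zero i b ℓS ℓB hℓQ parS (prodCfg U₀ η a) p q hne)
    (fun a ha p => rowSum_site_toMatrix_QpY_le_of i b parS U₀ η hcb hcb0 hcl hcl0 hKQ hQf hQb hCQ ha p)
    (fun q p => differentiableOn_toMatrix_QpsY_prodCfg_of i b parS U₀ η hcb hQh hQhi q p)
    (fun a _ q p hne => tdist_le_of_toMatrix_QpsY_ne_zero i b ℓS ℓB hℓQs parS (prodCfg U₀ η a) q p hne)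
    (fun a ha p => colSum_site_toMatrix_QpsY_le_of i b parS U₀ η hcb hcb0 hcl hcl0 hKQ hQsf hQsb hCQs ha p)
  refine rawEntryLetters_congr hS fun a _ => ?_
  rw [toMatrix_XY_eq]

end XQuad

/-! ## §3. ★★★ The X⁻¹-junction, transporter-generic -/

section XInv

/-- ★★★ **THE X⁻¹-JUNCTION FOR ANY `parS`, `Gp`**: §2 fed to p601656 §5 (`prodCfg_zero`, p599011 `XY_mul_XinvY`) ⟹ `RawEntryLetters (A′ ↦ toMatrix
((Q′G′²Q′*)⁻¹(e^{iηA′}U₀))) (ℓB ∘ fst) R₁⋆ ρ′ (2·cb·cl·B_X)` at the located thin radius for every `0 ≤ ρ′ < ρ − μ`, DISPLAYING: `Gp`'s pencil letters, the transporter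
facts, N06's `IsUnit (X(U₀))` + the pointwise (3.48)∕(3.108)-type bound for `X(U₀)⁻¹` at the ONE real background, NODE 00's numerals, fibre bounds.
[cite: Balaban1985BackgroundPropagators, (3.25) p.394, Thm 3.2 p.398, (3.48) p.398, Thm 3.4 p.400, (3.66)–(3.68) p.403, (3.69)–(3.70) p.404, Thm 3.10 (3.107)–(3.108) p.416;
Balaban1988RG2Cluster, (2.5)–(2.7) pp.12–13, p.15] -/
theorem rawEntryLetters_toMatrix_XinvY_prodCfg_of_pencil_of (Gp : SiteOpY 𝔸 i) {cb cl : ℝ}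
    (hcb : ∀ (x : 𝔸) (k : κ), ‖b.repr x k‖ ≤ cb * ‖x‖) (hcb0 : 0 ≤ cb) (hcl : ∀ l, ‖b l‖ ≤ cl) (hcl0 : 0 ≤ cl) (hKQ : 0 ≤ KQ) (hRc : 0 < Rc)
    (hQh : ∀ s z, DifferentiableOn ℂ (fun a : Fin (d + 1) → Site (PV d ℓ i.m i.K hd hL) 0 → 𝔸 => (qpT i parS (prodCfg U₀ η a) s z : 𝔸)) (ball 0 Rc))
    (hQhi : ∀ s z, DifferentiableOn ℂ (fun a : Fin (d + 1) → Site (PV d ℓ i.m i.K hd hL) 0 → 𝔸 =>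
      (((qpT i parS (prodCfg U₀ η a) s z)⁻¹ : 𝔸ˣ) : 𝔸)) (ball 0 Rc))
    (hQf : ∀ a ∈ ball (0 : Fin (d + 1) → Site (PV d ℓ i.m i.K hd hL) 0 → 𝔸) Rc, ∀ s z, qpK i s z ≠ 0 → ‖(qpT i parS (prodCfg U₀ η a) s z : 𝔸)‖ ≤ KQ)
    (hQb : ∀ a ∈ ball (0 : Fin (d + 1) → Site (PV d ℓ i.m i.K hd hL) 0 → 𝔸) Rc, ∀ s z, qpK i s z ≠ 0 →
      ‖(((qpT i parS (prodCfg U₀ η a) s z)⁻¹ : 𝔸ˣ) : 𝔸)‖ ≤ KQ)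
    (hQsf : ∀ a ∈ ball (0 : Fin (d + 1) → Site (PV d ℓ i.m i.K hd hL) 0 → 𝔸) Rc, ∀ z s, qpsK i z s ≠ 0 →
      ‖(((qpT i parS (prodCfg U₀ η a) s z)⁻¹ : 𝔸ˣ) : 𝔸)‖ ≤ KQ)
    (hQsb : ∀ a ∈ ball (0 : Fin (d + 1) → Site (PV d ℓ i.m i.K hd hL) 0 → 𝔸) Rc, ∀ z s, qpsK i z s ≠ 0 → ‖(qpT i parS (prodCfg U₀ η a) s z : 𝔸)‖ ≤ KQ)
    {CQ CQs : ℝ} (hCQ0 : 0 ≤ CQ) (hCQ : ∀ s, ∑ z, |qpK i s z| ≤ CQ) (hCQs0 : 0 ≤ CQs) (hCQs : ∀ s, ∑ z, |qpsK i z s| ≤ CQs)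
    (ℓS : SiteY i → UT Nf) (ℓB : BlkY i → UT Nf) {r : ℝ}
    (hℓQ : ∀ s z, qpK i s z ≠ 0 → tdist1 Nf (ℓB s) (ℓS z) ≤ r) (hℓQs : ∀ z s, qpsK i z s ≠ 0 → tdist1 Nf (ℓS z) (ℓB s) ≤ r)
    {mS mB : ℕ} (hfibS : ∀ y : UT Nf, (univ.filter fun q : SiteY i × κ => ℓS q.1 = y).card ≤ mS)
    (hfibB : ∀ y : UT Nf, (univ.filter fun p : BlkY i × κ => ℓB p.1 = y).card ≤ mB)
    {ρ BG μ : ℝ}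
    (hG : RawEntryLetters (fun a : Fin (d + 1) → Site (PV d ℓ i.m i.K hd hL) 0 → 𝔸 =>
      LinearMap.toMatrix ((Pi.basis fun _ : SiteY i => b).reindex (Equiv.sigmaEquivProd (SiteY i) κ))
        ((Pi.basis fun _ : SiteY i => b).reindex (Equiv.sigmaEquivProd (SiteY i) κ)) (Gp (prodCfg U₀ η a)))
      (fun q : SiteY i × κ => ℓS q.1) Rc ρ BG)
    (hμ : 0 < μ) (hμρ : μ ≤ ρ)
    (hunit : IsUnit (XY i parS Gp U₀)) {BX : ℝ} (hBX : 0 ≤ BX)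
    (hO : ∀ s t (E : 𝔸), ‖XinvY i parS Gp U₀ (Pi.single s E) t‖ ≤ BX * ‖E‖ * Real.exp (-((ρ - μ) * tdist1 Nf (ℓB t) (ℓB s))))
    {ρ' : ℝ} (hρ'0 : 0 ≤ ρ') (hρ' : ρ' < ρ - μ) :
    RawEntryLetters (fun a : Fin (d + 1) → Site (PV d ℓ i.m i.K hd hL) 0 → 𝔸 =>
        LinearMap.toMatrix ((Pi.basis fun _ : BlkY i => b).reindex (Equiv.sigmaEquivProd (BlkY i) κ))
          ((Pi.basis fun _ : BlkY i => b).reindex (Equiv.sigmaEquivProd (BlkY i) κ)) (XinvY i parS Gp (prodCfg U₀ η a)))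
      (fun p : BlkY i × κ => ℓB p.1)
      (Rc / (4 * ((CQ * (Fintype.card κ : ℝ) * (cb * (KQ * cl * KQ)) * (CQs * (Fintype.card κ : ℝ) * (cb * (KQ * cl * KQ))) * (BG * BG * (mS * B6.c0 1 μ ^ ν)) * Real.exp (2 * (ρ - μ) * r)) * (cb * cl * BX) *
          (mB * B6.c0 1 ((ρ - μ - ρ') / 3) ^ ν) * (mB * B6.c0 1 ((ρ - μ - ρ') / 3) ^ ν)) + 1))
      ρ' (2 * (cb * cl * BX)) := by
  have hX := rawEntryLetters_toMatrix_XY_prodCfg_of i b parS U₀ η Gp hcb hcb0 hcl hcl0 hKQ hQh hQhi hQf hQb hQsf hQsb hCQ0 hCQ hCQs0 hCQs ℓS ℓB hℓQ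
    hℓQs hfibS hG hμ hμρ
  have h0 : XY i parS Gp (prodCfg U₀ η 0) * XinvY i parS Gp U₀ = 1 := by
    rw [prodCfg_zero]
    exact XY_mul_XinvY i hunit
  exact rawEntryLetters_toMatrix_ringInverse_located_of_kernelBound b (fun a => XY i parS Gp (prodCfg U₀ η a)) ℓB hX h0 hcb hcb0 hcl hcl0 hBX hO hfibB
    hRc hρ'0 hρ'

end XInv

/-! ## §4. The v2 and v4 instances -/

section Instances

variable [NormOneClass 𝔸]

/-- **THE X⁻¹-JUNCTION AT def-Y's v2 LETTER `parSY`** (any `Gp`): §3 with the transporter facts discharged by 73 (`KQ = Kη^D`) — the statement of the v2-keyed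
`B13OpsYPencilXQuad.rawEntryLetters_toMatrix_XinvY_prodCfg_of_pencil` recovered for a GENERAL `G′`-letter.
[cite: Balaban1985BackgroundPropagators, (3.25) p.394, Thm 3.2 p.398, (3.66)–(3.68) p.403, (3.69)–(3.70) p.404, Thm 3.10 (3.108) p.416] -/
theorem rawEntryLetters_toMatrix_XinvY_parSY_prodCfg_of_pencil (Gp : SiteOpY 𝔸 i) {K₀ : ℝ} {D : ℕ}
    (hU : ∀ μ x, ‖(U₀ μ x : 𝔸)‖ ≤ K₀) (hUi : ∀ μ x, ‖(((U₀ μ x)⁻¹ : 𝔸ˣ) : 𝔸)‖ ≤ K₀) (hK1 : 1 ≤ K₀) (hRc : 0 < Rc)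
    (hD : ∀ s z, qpK i s z ≠ 0 → Site.tdist ((boxEquiv i.hN).symm (blkCornerY i s)) ((boxEquiv i.hN).symm z) ≤ D)
    (hDs : ∀ z s, qpsK i z s ≠ 0 → Site.tdist ((boxEquiv i.hN).symm (blkCornerY i s)) ((boxEquiv i.hN).symm z) ≤ D)
    {cb cl : ℝ} (hcb : ∀ (x : 𝔸) (k : κ), ‖b.repr x k‖ ≤ cb * ‖x‖) (hcb0 : 0 ≤ cb) (hcl : ∀ l, ‖b l‖ ≤ cl) (hcl0 : 0 ≤ cl)
    {CQ CQs : ℝ} (hCQ0 : 0 ≤ CQ) (hCQ : ∀ s, ∑ z, |qpK i s z| ≤ CQ) (hCQs0 : 0 ≤ CQs) (hCQs : ∀ s, ∑ z, |qpsK i z s| ≤ CQs)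
    (ℓS : SiteY i → UT Nf) (ℓB : BlkY i → UT Nf) {r : ℝ}
    (hℓQ : ∀ s z, qpK i s z ≠ 0 → tdist1 Nf (ℓB s) (ℓS z) ≤ r) (hℓQs : ∀ z s, qpsK i z s ≠ 0 → tdist1 Nf (ℓS z) (ℓB s) ≤ r)
    {mS mB : ℕ} (hfibS : ∀ y : UT Nf, (univ.filter fun q : SiteY i × κ => ℓS q.1 = y).card ≤ mS)
    (hfibB : ∀ y : UT Nf, (univ.filter fun p : BlkY i × κ => ℓB p.1 = y).card ≤ mB)
    {ρ BG μ : ℝ}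
    (hG : RawEntryLetters (fun a : Fin (d + 1) → Site (PV d ℓ i.m i.K hd hL) 0 → 𝔸 =>
      LinearMap.toMatrix ((Pi.basis fun _ : SiteY i => b).reindex (Equiv.sigmaEquivProd (SiteY i) κ))
        ((Pi.basis fun _ : SiteY i => b).reindex (Equiv.sigmaEquivProd (SiteY i) κ)) (Gp (prodCfg U₀ η a)))
      (fun q : SiteY i × κ => ℓS q.1) Rc ρ BG)
    (hμ : 0 < μ) (hμρ : μ ≤ ρ)
    (hunit : IsUnit (XY i (parSY i) Gp U₀)) {BX : ℝ} (hBX : 0 ≤ BX)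
    (hO : ∀ s t (E : 𝔸), ‖XinvY i (parSY i) Gp U₀ (Pi.single s E) t‖ ≤ BX * ‖E‖ * Real.exp (-((ρ - μ) * tdist1 Nf (ℓB t) (ℓB s))))
    {ρ' : ℝ} (hρ'0 : 0 ≤ ρ') (hρ' : ρ' < ρ - μ) :
    RawEntryLetters (fun a : Fin (d + 1) → Site (PV d ℓ i.m i.K hd hL) 0 → 𝔸 =>
        LinearMap.toMatrix ((Pi.basis fun _ : BlkY i => b).reindex (Equiv.sigmaEquivProd (BlkY i) κ))
          ((Pi.basis fun _ : BlkY i => b).reindex (Equiv.sigmaEquivProd (BlkY i) κ)) (XinvY i (parSY i) Gp (prodCfg U₀ η a)))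
      (fun p : BlkY i × κ => ℓB p.1)
      (Rc / (4 * ((CQ * (Fintype.card κ : ℝ) * (cb * ((K₀ * Real.exp (|η| * Rc)) ^ D * cl * (K₀ * Real.exp (|η| * Rc)) ^ D)) * (CQs * (Fintype.card κ : ℝ) * (cb * ((K₀ * Real.exp (|η| * Rc)) ^ D * cl * (K₀ * Real.exp (|η| * Rc)) ^ D))) * (BG * BG * (mS * B6.c0 1 μ ^ ν)) * Real.exp (2 * (ρ - μ) * r)) * (cb * cl * BX) *
          (mB * B6.c0 1 ((ρ - μ - ρ') / 3) ^ ν) * (mB * B6.c0 1 ((ρ - μ - ρ') / 3) ^ ν)) + 1))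
      ρ' (2 * (cb * cl * BX)) := by
  have h1 : (1 : ℝ) ≤ K₀ * Real.exp (|η| * Rc) := one_le_mul_of_one_le_of_one_le hK1 (Real.one_le_exp (mul_nonneg (abs_nonneg _) hRc.le))
  have hKQ : 0 ≤ (K₀ * Real.exp (|η| * Rc)) ^ D := pow_nonneg (zero_le_one.trans h1) D
  exact rawEntryLetters_toMatrix_XinvY_prodCfg_of_pencil_of i b (parSY i) U₀ η Gp hcb hcb0 hcl hcl0 hKQ hRc
    (fun s z => differentiableOn_qpT_prodCfg i U₀ η s z) (fun s z => differentiableOn_qpT_inv_prodCfg i U₀ η s z)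
    (fun a ha s z hM => (norm_qpT_prodCfg_le i U₀ η hU hUi hRc.le ha s z).trans (pow_le_pow_right₀ h1 (hD s z hM)))
    (fun a ha s z hM => (norm_qpT_inv_prodCfg_le i U₀ η hU hUi hRc.le ha s z).trans (pow_le_pow_right₀ h1 (hD s z hM)))
    (fun a ha z s hM => (norm_qpT_inv_prodCfg_le i U₀ η hU hUi hRc.le ha s z).trans (pow_le_pow_right₀ h1 (hDs z s hM)))
    (fun a ha z s hM => (norm_qpT_prodCfg_le i U₀ η hU hUi hRc.le ha s z).trans (pow_le_pow_right₀ h1 (hDs z s hM)))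
    hCQ0 hCQ hCQs0 hCQs ℓS ℓB hℓQ hℓQs hfibS hfibB hG hμ hμρ hunit hBX hO hρ'0 hρ'

/-- **THE X⁻¹-JUNCTION AT def-Y's v4 LETTER `parSymY`** (N06's record face; any `Gp`): §3 with the transporter facts discharged by the lane's 78 §1
(`qpT i parSymY U s z = parSymY U (corner s) z` by `rfl`; `KQ = Kη^D`).
[cite: Balaban1985BackgroundPropagators, (3.25) p.394, Thm 3.2 p.398, (3.66)–(3.68) p.403, (3.69)–(3.70) p.404, Thm 3.10 (3.108) p.416] -/
theorem rawEntryLetters_toMatrix_XinvY_parSymY_prodCfg_of_pencil (Gp : SiteOpY 𝔸 i) {K₀ : ℝ} {D : ℕ}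
    (hU : ∀ μ x, ‖(U₀ μ x : 𝔸)‖ ≤ K₀) (hUi : ∀ μ x, ‖(((U₀ μ x)⁻¹ : 𝔸ˣ) : 𝔸)‖ ≤ K₀) (hK1 : 1 ≤ K₀) (hRc : 0 < Rc)
    (hD : ∀ s z, qpK i s z ≠ 0 → Site.tdist ((boxEquiv i.hN).symm (blkCornerY i s)) ((boxEquiv i.hN).symm z) ≤ D)
    (hDs : ∀ z s, qpsK i z s ≠ 0 → Site.tdist ((boxEquiv i.hN).symm (blkCornerY i s)) ((boxEquiv i.hN).symm z) ≤ D)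
    {cb cl : ℝ} (hcb : ∀ (x : 𝔸) (k : κ), ‖b.repr x k‖ ≤ cb * ‖x‖) (hcb0 : 0 ≤ cb) (hcl : ∀ l, ‖b l‖ ≤ cl) (hcl0 : 0 ≤ cl)
    {CQ CQs : ℝ} (hCQ0 : 0 ≤ CQ) (hCQ : ∀ s, ∑ z, |qpK i s z| ≤ CQ) (hCQs0 : 0 ≤ CQs) (hCQs : ∀ s, ∑ z, |qpsK i z s| ≤ CQs)
    (ℓS : SiteY i → UT Nf) (ℓB : BlkY i → UT Nf) {r : ℝ}
    (hℓQ : ∀ s z, qpK i s z ≠ 0 → tdist1 Nf (ℓB s) (ℓS z) ≤ r) (hℓQs : ∀ z s, qpsK i z s ≠ 0 → tdist1 Nf (ℓS z) (ℓB s) ≤ r)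
    {mS mB : ℕ} (hfibS : ∀ y : UT Nf, (univ.filter fun q : SiteY i × κ => ℓS q.1 = y).card ≤ mS)
    (hfibB : ∀ y : UT Nf, (univ.filter fun p : BlkY i × κ => ℓB p.1 = y).card ≤ mB)
    {ρ BG μ : ℝ}
    (hG : RawEntryLetters (fun a : Fin (d + 1) → Site (PV d ℓ i.m i.K hd hL) 0 → 𝔸 =>
      LinearMap.toMatrix ((Pi.basis fun _ : SiteY i => b).reindex (Equiv.sigmaEquivProd (SiteY i) κ))
        ((Pi.basis fun _ : SiteY i => b).reindex (Equiv.sigmaEquivProd (SiteY i) κ)) (Gp (prodCfg U₀ η a)))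
      (fun q : SiteY i × κ => ℓS q.1) Rc ρ BG)
    (hμ : 0 < μ) (hμρ : μ ≤ ρ)
    (hunit : IsUnit (XY i (parSymY i) Gp U₀)) {BX : ℝ} (hBX : 0 ≤ BX)
    (hO : ∀ s t (E : 𝔸), ‖XinvY i (parSymY i) Gp U₀ (Pi.single s E) t‖ ≤ BX * ‖E‖ * Real.exp (-((ρ - μ) * tdist1 Nf (ℓB t) (ℓB s))))
    {ρ' : ℝ} (hρ'0 : 0 ≤ ρ') (hρ' : ρ' < ρ - μ) :
    RawEntryLetters (fun a : Fin (d + 1) → Site (PV d ℓ i.m i.K hd hL) 0 → 𝔸 =>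
        LinearMap.toMatrix ((Pi.basis fun _ : BlkY i => b).reindex (Equiv.sigmaEquivProd (BlkY i) κ))
          ((Pi.basis fun _ : BlkY i => b).reindex (Equiv.sigmaEquivProd (BlkY i) κ)) (XinvY i (parSymY i) Gp (prodCfg U₀ η a)))
      (fun p : BlkY i × κ => ℓB p.1)
      (Rc / (4 * ((CQ * (Fintype.card κ : ℝ) * (cb * ((K₀ * Real.exp (|η| * Rc)) ^ D * cl * (K₀ * Real.exp (|η| * Rc)) ^ D)) * (CQs * (Fintype.card κ : ℝ) * (cb * ((K₀ * Real.exp (|η| * Rc)) ^ D * cl * (K₀ * Real.exp (|η| * Rc)) ^ D))) * (BG * BG * (mS * B6.c0 1 μ ^ ν)) * Real.exp (2 * (ρ - μ) * r)) * (cb * cl * BX) *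
          (mB * B6.c0 1 ((ρ - μ - ρ') / 3) ^ ν) * (mB * B6.c0 1 ((ρ - μ - ρ') / 3) ^ ν)) + 1))
      ρ' (2 * (cb * cl * BX)) := by
  have h1 : (1 : ℝ) ≤ K₀ * Real.exp (|η| * Rc) := one_le_mul_of_one_le_of_one_le hK1 (Real.one_le_exp (mul_nonneg (abs_nonneg _) hRc.le))
  have hKQ : 0 ≤ (K₀ * Real.exp (|η| * Rc)) ^ D := pow_nonneg (zero_le_one.trans h1) D
  exact rawEntryLetters_toMatrix_XinvY_prodCfg_of_pencil_of i b (parSymY i) U₀ η Gp hcb hcb0 hcl hcl0 hKQ hRc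
    (fun s z => differentiableOn_parSymY_prodCfg i U₀ η (blkCornerY i s) z) (fun s z => differentiableOn_parSymY_inv_prodCfg i U₀ η (blkCornerY i s) z)
    (fun a ha s z hM => (norm_parSymY_prodCfg_le i U₀ η hU hUi hRc.le ha (blkCornerY i s) z).trans (pow_le_pow_right₀ h1 (hD s z hM)))
    (fun a ha s z hM => (norm_parSymY_inv_prodCfg_le i U₀ η hU hUi hRc.le ha (blkCornerY i s) z).trans (pow_le_pow_right₀ h1 (hD s z hM)))
    (fun a ha z s hM => (norm_parSymY_inv_prodCfg_le i U₀ η hU hUi hRc.le ha (blkCornerY i s) z).trans (pow_le_pow_right₀ h1 (hDs z s hM)))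
    (fun a ha z s hM => (norm_parSymY_prodCfg_le i U₀ η hU hUi hRc.le ha (blkCornerY i s) z).trans (pow_le_pow_right₀ h1 (hDs z s hM)))
    hCQ0 hCQ hCQs0 hCQs ℓS ℓB hℓQ hℓQs hfibS hfibB hG hμ hμρ hunit hBX hO hρ'0 hρ'

end Instances

end Literature.MathematicalPhysics.QuantumFieldTheory.Balaban1983to89.B13OpsYPencilXQuadGen

end
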